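import Mathlib
import HarnessLib
import Summits.AtomisticToContinuum.FouriersLaw.Theses.JunctionLocality
import Summits.AtomisticToContinuum.FouriersLaw.Theses.SpatialCentreManifold

/-!
# `SuperadditiveResistance` is the superadditive half of the affine resistance law
(crux `JunctionLocality.SuperadditiveResistance`, stmt-AtomisticToContinuum-11748; helper `--supports` it; lead c7, 2026-08-17)

The crux (A) asks, along the weak-NESS shell of `pinnedChain ω₂ lam β γ`, for a constant `C` with
`R_N + R_M − C ≤ R_{N+M}` (`N, M ≥ 2`), `R_N := (N−1)/D_N`. Route `SpatialCentreManifold` carries, over the SAME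
shell (same uniqueness hypothesis, same steady-state families, same response coefficients), the two-sided named
rate statements

* `AffineResistanceLaw` (stmt-AtomisticToContinuum-13407): `∃ r > 0 ∀ family ∀ D ∃ C ∀ N, |R_N − (N−1)·r| ≤ C`
  (Fourier's law WITH the `1/N` finite-size rate), and
* `AdditiveContactResistance` (stmt-AtomisticToContinuum-13408): `R_N − (N−1)·r → c` (bulk + two contacts).

This file records the elementary implications

  `AdditiveContactResistance → SuperadditiveResistance`, `AffineResistanceLaw → SuperadditiveResistance`

(real analysis: `R_N ≤ (N−1)r + C`, `R_M ≤ (M−1)r + C`, `R_{N+M} ≥ (N+M−1)r − C` give the insertion bound with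
constant `3C`, using only `r ≥ 0`; a convergent sequence is bounded). Purpose: the crux closes BY NAME the moment
either rate statement lands (the gate's `shared_closes` then serves the verbatim twins
`ParityLiouvilleSeed.SuperadditiveResistance`, `LogConcaveRigidity.SuperadditiveResistance`). The converse is false as
a matter of logic ((A) is one-sided: it is compatible with a ballistic member, `JunctionLocality.HarmonicCalibration`),
so nothing here claims equivalence. Standard axioms; no named fact is taken.
-/

noncomputable section

open MeasureTheory Filter Topology
open Literature.MathematicalPhysics.KineticTheory.HeatConduction

namespace Summit.AtomisticToContinuum.FouriersLaw.Cruxes.SuperadditiveResistance.OfAffineResistanceLaw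

/-- **Real-analysis core.** If the resistances `R_N = (N−1)/D_N` stay within `C` of the affine law `(N−1)·r` with
`r ≥ 0` for all `N ≥ 2`, then the insertion cost is bounded: `R_N + R_M − 3C ≤ R_{N+M}` for `N, M ≥ 2`
(indeed `R_N + R_M − 3C ≤ (N+M−2)r − C ≤ (N+M−1)r − C ≤ R_{N+M}`). -/
theorem insertionBounded_of_affine_bounds {D : ℕ → ℝ} {r C : ℝ} (hr : 0 ≤ r)
    (h : ∀ N : ℕ, 2 ≤ N → |((N : ℝ) - 1) / D N - ((N : ℝ) - 1) * r| ≤ C) :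
    ∃ C' : ℝ, ∀ N M : ℕ, 2 ≤ N → 2 ≤ M →
      ((N : ℝ) - 1) / D N + ((M : ℝ) - 1) / D M - C' ≤ ((N : ℝ) + (M : ℝ) - 1) / D (N + M) := by
  refine ⟨3 * C, fun N M hN hM => ?_⟩
  have h1 := abs_le.mp (h N hN)
  have h2 := abs_le.mp (h M hM)
  have h3 := abs_le.mp (h (N + M) (by omega))
  have hcast : ((N + M : ℕ) : ℝ) = (N : ℝ) + (M : ℝ) := by push_cast; ring
  rw [hcast] at h3
  obtain ⟨_, h1u⟩ := h1
  obtain ⟨_, h2u⟩ := h2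
  obtain ⟨h3l, _⟩ := h3
  nlinarith [hr, h1u, h2u, h3l]

/-- **`AffineResistanceLaw → SuperadditiveResistance`.** Instantiate the affine law (stmt-AtomisticToContinuum-13407)
at the crux's parameters, uniqueness hypothesis and temperature, feed it the crux's steady-state family and response
coefficients, and apply `insertionBounded_of_affine_bounds` (the positivity hypothesis of the crux is not needed). -/
theorem superadditiveResistance_of_affineResistanceLaw :
    Summit.AtomisticToContinuum.FouriersLaw.Theses.SpatialCentreManifold.AffineResistanceLaw →
      Summit.AtomisticToContinuum.FouriersLaw.Theses.JunctionLocality.SuperadditiveResistance := by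
  intro h ω₂ lam β γ hω hl hβ hγ hU μ hμ T hT D hD _hpos
  obtain ⟨r, hr, hfam⟩ := h ω₂ lam β γ hω hl hβ hγ hU T hT
  obtain ⟨C, hC⟩ := hfam μ hμ D hD
  exact insertionBounded_of_affine_bounds hr.le fun N _ => hC N

/-- **`AdditiveContactResistance → SuperadditiveResistance`.** A convergent contact correction
`R_N − (N−1)·r → c` (stmt-AtomisticToContinuum-13408) is bounded in absolute value along `ℕ`
(`Filter.Tendsto.bddAbove_range` applied to `|·|`), whence the affine bounds and the insertion bound. -/
theorem superadditiveResistance_of_additiveContactResistance :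
    Summit.AtomisticToContinuum.FouriersLaw.Theses.SpatialCentreManifold.AdditiveContactResistance →
      Summit.AtomisticToContinuum.FouriersLaw.Theses.JunctionLocality.SuperadditiveResistance := by
  intro h ω₂ lam β γ hω hl hβ hγ hU μ hμ T hT D hD _hpos
  obtain ⟨r, hr, c, hfam⟩ := h ω₂ lam β γ hω hl hβ hγ hU T hT
  have hlim := (hfam μ hμ D hD).abs
  obtain ⟨B, hB⟩ := hlim.bddAbove_range
  exact insertionBounded_of_affine_bounds (C := B) hr.le fun N _ => hB ⟨N, rfl⟩

end Summit.AtomisticToContinuum.FouriersLaw.Cruxes.SuperadditiveResistance.OfAffineResistanceLaw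

end
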